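import Summits.KontsevichZagierPeriods.KontsevichZagierPeriods.Theorems.K2SymbolChainsJensenIsScissorsRotationAux

/-!
# Jensen is scissors — scalar identities for the inversion `s ↦ −1/s` and the doubling chart
# `s ↦ 2s/(1 − s²)`

Support file for item stmt-KontsevichZagierPeriods-5204 (`JensenIsScissors`, route
KontsevichZagierPeriods/K2SymbolChains). For a real centre `ρ` write
`W_ρ(s) = ((1 − ρ)² + (1 + ρ)² s²)/(1 + s²)` (`= |e^{iφ} − ρ|²`, `s = tan(φ/2)`). The rotation by
`π`, `s ↦ −1/s`, carries `W_ρ` to `W_{−ρ}` and preserves `ds/(1 + s²)`; the two-sheeted doubling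
`φ ↦ 2φ`, `s ↦ 2s/(1 − s²)` (a bijection from `(−1, 1)` onto `ℝ` and from `{|s| > 1}` onto `ℝ ∖ {0}`,
with the explicit inverses `t/(1 + √(1 + t²))`, `−(1 + √(1 + t²))/t`), carries `W_{ρ²}` back to
`W_ρ · W_{−ρ}` (`|e^{2iφ} − ρ²| = |e^{iφ} − ρ| |e^{iφ} + ρ|`) and doubles `ds/(1 + s²)`. We also record
the differentiability of `(x, s) ↦ W_{ρ(x)}(s)` for differentiable `ρ`. [folklore]
-/

noncomputable section

open MeasureTheory Set
open Literature.NumberTheory.Transcendental Literature.ModelTheory.ExponentialFields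

namespace Summit.KontsevichZagierPeriods.K2SymbolChains.JensenIsScissorsProof

open Literature.NumberTheory.Transcendental.KZ

variable {n : ℕ}

/-! ### The inversion `s ↦ −1/s` -/

/-- `W_{−ρ}(−1/s) = W_ρ(s)`. [folklore] -/
theorem inv_W (ρ : ℝ) {s : ℝ} (hs : s ≠ 0) :
    ((1 + ρ) ^ 2 + (1 - ρ) ^ 2 * (-s⁻¹) ^ 2) / (1 + (-s⁻¹) ^ 2) =
      ((1 - ρ) ^ 2 + (1 + ρ) ^ 2 * s ^ 2) / (1 + s ^ 2) := by
  have h1 : (1 + s ^ 2) ≠ 0 := by positivity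
  field_simp
  ring

/-- The inversion preserves `ds/(1 + s²)`: `(c/(1 + (−1/s)²)) · (1/s²) = c/(1 + s²)`. [folklore] -/
theorem inv_weight (c : ℝ) {s : ℝ} (hs : s ≠ 0) :
    c / (1 + (-s⁻¹) ^ 2) * (s ^ 2)⁻¹ = c / (1 + s ^ 2) := by
  have h1 : (1 + s ^ 2) ≠ 0 := by positivity
  field_simp
  ring

/-- The derivative of `t ↦ −1/t` is `1/t²`. [folklore] -/
theorem hasDerivAt_neg_inv {s : ℝ} (hs : s ≠ 0) : HasDerivAt (fun t : ℝ => -t⁻¹) ((s ^ 2)⁻¹) s := by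
  have h := (hasDerivAt_inv hs).neg
  simp only [neg_neg] at h
  exact h

/-! ### The doubling chart `s ↦ 2s/(1 − s²)` -/

/-- `W_ρ(s) · W_{−ρ}(s) = W_{ρ²}(2s/(1 − s²))`. [folklore] -/
theorem dbl_W (ρ : ℝ) {s : ℝ} (hs : 1 - s ^ 2 ≠ 0) :
    ((1 - ρ) ^ 2 + (1 + ρ) ^ 2 * s ^ 2) / (1 + s ^ 2) * (((1 + ρ) ^ 2 + (1 - ρ) ^ 2 * s ^ 2) / (1 + s ^ 2)) =
      ((1 - ρ ^ 2) ^ 2 + (1 + ρ ^ 2) ^ 2 * (2 * s / (1 - s ^ 2)) ^ 2) / (1 + (2 * s / (1 - s ^ 2)) ^ 2) := by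
  have h1 : (1 + s ^ 2) ≠ 0 := by positivity
  field_simp
  ring

/-- The doubling chart doubles `ds/(1 + s²)`: `((c/2)/(1 + ψ²)) · ψ' = c/(1 + s²)`. [folklore] -/
theorem dbl_weight (c : ℝ) {s : ℝ} (hs : 1 - s ^ 2 ≠ 0) :
    c / 2 / (1 + (2 * s / (1 - s ^ 2)) ^ 2) * (2 * (1 + s ^ 2) / (1 - s ^ 2) ^ 2) = c / (1 + s ^ 2) := by
  have h1 : (1 + s ^ 2) ≠ 0 := by positivity
  field_simp
  ring

/-- The derivative of the doubling chart. [folklore] -/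
theorem hasDerivAt_dbl {s : ℝ} (hs : 1 - s ^ 2 ≠ 0) :
    HasDerivAt (fun t : ℝ => 2 * t / (1 - t ^ 2)) (2 * (1 + s ^ 2) / (1 - s ^ 2) ^ 2) s := by
  have h := hasDerivAt_quad_div (c₀ := 0) (c₁ := 2) (c₂ := 0) (d₀ := 1) (d₁ := 0) (d₂ := -1) (t := s)
    (by convert hs using 1; ring)
  have hfun : (fun t : ℝ => 2 * t / (1 - t ^ 2)) = fun t => (0 * t ^ 2 + 2 * t + 0) / (-1 * t ^ 2 + 0 * t + 1) := by
    funext t; congr 1 <;> ring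
  rw [hfun]
  refine h.congr_deriv ?_
  rw [div_eq_div_iff (by convert pow_ne_zero 2 hs using 1; ring) (pow_ne_zero 2 hs)]
  ring

/-- The doubling chart is positive-sloped. [folklore] -/
theorem dbl_deriv_pos {s : ℝ} (hs : 1 - s ^ 2 ≠ 0) : 0 < 2 * (1 + s ^ 2) / (1 - s ^ 2) ^ 2 := by
  have : 0 < (1 - s ^ 2) ^ 2 := by positivity
  positivity

/-- Injectivity of the doubling chart on `{s² < 1}`. [folklore] -/
theorem dbl_inj_of_lt {s t : ℝ} (hs : s ^ 2 < 1) (ht : t ^ 2 < 1)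
    (h : 2 * s / (1 - s ^ 2) = 2 * t / (1 - t ^ 2)) : s = t := by
  have hs' : 1 - s ^ 2 ≠ 0 := by linarith
  have ht' : 1 - t ^ 2 ≠ 0 := by linarith
  rw [div_eq_div_iff hs' ht'] at h
  have hfac : (s - t) * (1 + s * t) = 0 := by linarith
  rcases mul_eq_zero.1 hfac with h0 | h0
  · linarith
  · have hst : s * t = -1 := by linarith
    have : (s * t) ^ 2 = 1 := by rw [hst]; norm_num
    nlinarith [sq_nonneg s, sq_nonneg t]

/-- Injectivity of the doubling chart on `{1 < s²}`. [folklore] -/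
theorem dbl_inj_of_gt {s t : ℝ} (hs : 1 < s ^ 2) (ht : 1 < t ^ 2)
    (h : 2 * s / (1 - s ^ 2) = 2 * t / (1 - t ^ 2)) : s = t := by
  have hs' : 1 - s ^ 2 ≠ 0 := by linarith
  have ht' : 1 - t ^ 2 ≠ 0 := by linarith
  rw [div_eq_div_iff hs' ht'] at h
  have hfac : (s - t) * (1 + s * t) = 0 := by linarith
  rcases mul_eq_zero.1 hfac with h0 | h0
  · linarith
  · have hst : s * t = -1 := by linarith
    have : (s * t) ^ 2 = 1 := by rw [hst]; norm_num
    nlinarith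

/-- The inverse of the doubling chart on the first sheet: `t/(1 + √(1 + t²)) ∈ (−1, 1)` maps to
`t`. [folklore] -/
theorem dbl_inv₁ (t : ℝ) :
    (t / (1 + Real.sqrt (1 + t ^ 2))) ^ 2 < 1 ∧
      2 * (t / (1 + Real.sqrt (1 + t ^ 2))) / (1 - (t / (1 + Real.sqrt (1 + t ^ 2))) ^ 2) = t := by
  set u := Real.sqrt (1 + t ^ 2) with hu
  have hu0 : 0 < u := Real.sqrt_pos.2 (by positivity)
  have hu2 : u ^ 2 = 1 + t ^ 2 := Real.sq_sqrt (by positivity)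
  have h1u : 0 < 1 + u := by positivity
  have hlt : t ^ 2 < (1 + u) ^ 2 := by nlinarith
  refine ⟨?_, ?_⟩
  · rw [div_pow, div_lt_one (by positivity)]
    exact hlt
  · have hden : 1 - (t / (1 + u)) ^ 2 = 2 / (1 + u) := by
      field_simp
      nlinarith
    rw [hden]
    field_simp

/-- The inverse of the doubling chart on the second sheet: for `t ≠ 0`, `−(1 + √(1 + t²))/t` has
square `> 1` and maps to `t`. [folklore] -/
theorem dbl_inv₂ {t : ℝ} (ht : t ≠ 0) :
    1 < (-(1 + Real.sqrt (1 + t ^ 2)) / t) ^ 2 ∧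
      2 * (-(1 + Real.sqrt (1 + t ^ 2)) / t) / (1 - (-(1 + Real.sqrt (1 + t ^ 2)) / t) ^ 2) = t := by
  set u := Real.sqrt (1 + t ^ 2) with hu
  have hu0 : 0 < u := Real.sqrt_pos.2 (by positivity)
  have hu2 : u ^ 2 = 1 + t ^ 2 := Real.sq_sqrt (by positivity)
  have h1u : 0 < 1 + u := by positivity
  have hlt : t ^ 2 < (1 + u) ^ 2 := by nlinarith
  have ht2 : 0 < t ^ 2 := by positivity
  refine ⟨?_, ?_⟩
  · rw [div_pow, neg_sq, one_lt_div ht2]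
    exact hlt
  · have hden : 1 - (-(1 + u) / t) ^ 2 = -(2 * (1 + u)) / t ^ 2 := by
      field_simp
      nlinarith
    rw [hden]
    field_simp

/-! ### Differentiability of `W_{ρ(x)}(s)` in `(x, s)` -/

/-- `(x, s) ↦ ((a − c ρ(x))² + (a' + c' ρ(x))² s²)/(1 + s²)`-type functions are differentiable
where `ρ` is: the case used, `((p + q ρ)² + (p' + q' ρ)² s²)/(1 + s²)` with rational `p, q, p', q'`.
[folklore] -/
theorem differentiableAt_Wgen {ρ : (Fin n → ℝ) → ℝ} {b : Fin (n + 1) → ℝ}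
    (hρ : DifferentiableAt ℝ ρ (Fin.init b)) (p q p' q' : ℝ) :
    DifferentiableAt ℝ (fun b : Fin (n + 1) → ℝ => ((p + q * ρ (Fin.init b)) ^ 2 +
      (p' + q' * ρ (Fin.init b)) ^ 2 * b (Fin.last n) ^ 2) / (1 + b (Fin.last n) ^ 2)) b := by
  have hi : DifferentiableAt ℝ (fun w : Fin (n + 1) → ℝ => Fin.init w) b :=
    (ContinuousLinearMap.pi fun j => ContinuousLinearMap.proj (R := ℝ)
      (φ := fun _ : Fin (n + 1) => ℝ) (Fin.castSucc j)).differentiableAt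
  have hs : DifferentiableAt ℝ (fun w : Fin (n + 1) → ℝ => w (Fin.last n)) b :=
    differentiableAt_apply (Fin.last n) b
  have hr : DifferentiableAt ℝ (fun w : Fin (n + 1) → ℝ => ρ (Fin.init w)) b := hρ.comp b hi
  have hnum : DifferentiableAt ℝ (fun b : Fin (n + 1) → ℝ => (p + q * ρ (Fin.init b)) ^ 2 +
      (p' + q' * ρ (Fin.init b)) ^ 2 * b (Fin.last n) ^ 2) b :=
    (((differentiableAt_const _).add (hr.const_mul q)).pow 2).add
      ((((differentiableAt_const _).add (hr.const_mul q')).pow 2).mul (hs.pow 2))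
  have hden : DifferentiableAt ℝ (fun b : Fin (n + 1) → ℝ => 1 + b (Fin.last n) ^ 2) b :=
    (differentiableAt_const _).add (hs.pow 2)
  simp only [div_eq_mul_inv]
  exact hnum.mul (hden.inv (by positivity))

/-- The zero set of `((p + qρ)² + (p' + q'ρ)² s²)` with `p' + q'ρ ≠ 0` lies in `{s = 0}`; so the
signed unfolding base `{W ≠ 0}` is co-null. [folklore] -/
theorem W_ne_zero_of_ne {a c s : ℝ} (hc : c ≠ 0) (hs : s ≠ 0) : (a ^ 2 + c ^ 2 * s ^ 2) / (1 + s ^ 2) ≠ 0 := by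
  have : 0 < c ^ 2 * s ^ 2 := by positivity
  have : 0 < a ^ 2 + c ^ 2 * s ^ 2 := by positivity
  positivity


end Summit.KontsevichZagierPeriods.K2SymbolChains.JensenIsScissorsProof
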